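import Summits.Ventures.HSemireg.Pad4FirstOrderModelRayRuleLower

/-!
# Venture HSemireg — THEOREM L^ζ step S2b: the UPPER RAY RULE in the first-order model (THEOREM C′ «only if» at a
# `P`-constituent charged on two factors; companion of `Pad4FirstOrderModel.lean`, row 716; TIER-2 step S2b, director-hodge g9 «S2b GO», cell INBOX l.31189)

HONEST FRAMING. PROVED statement about the first-order MODEL of the PAD-4 anchor (seat s4-prove-1 g23, TRACK S4-PUSH lane
(ii), 2026-08-27). `TheoremLZetaMain` ∕ `TheoremLZeta` (p505821) stay kernel-OPEN (`@[conjecture]`); nothing here proves them.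
WHAT IS PROVED (`rayRule_upper`): in ANY design `D` with sections `φ` satisfying `Minimal`, if the `E₊`-side system of a
`P`-constituent `P j` charged on `σ` AND on a second factor `f ≠ σ` is solvable (`UpperRowSolvable`) at the Weil direction
`κ₀ = E_{fσ}`, then `P j` has a σ-RAY PARTNER STRICTLY ABOVE IT WITH AN ENTRY: some `N i` in its layer with the same
letter on every factor `g ≠ σ`, a larger σ-charge of `P j`'s phase, and a non-zero section coordinate `φ i j a`,
`a ∈ idxH0 (N i) (P j)`. This is PAD4-THEOREM-L v1.2 §5 (P0) «RAY RULE (P) for every P charged on ≥ 2 factors» [W5,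
s4-ref-2 g3; O1, s4-ref g66] in the kernel; the second charged factor `f` is NEEDED here (an `f`-charged `N` above an
`f`-uncharged `P` would feed `V_f` through two phases — [W5]'s caveat), and is used exactly once: every participant
`N i ≥ P j` then carries `P j`'s `f`-phase (`phase_eq_of_idxH0_of_charged`), so the `w_{ζ_f}` of the demand side (row 781)
and the `w_{ζ_f}` that kills the evaluation pairings on the left (row S2a's `coefProd_wImage_eq_zero`, reused verbatim
with `X := N i`, `P := P j`) are the same functional. Only the DIAGONAL upper row `s = j` is read (always kept:
`upperRowPure_self`). The top-flag combinatorics (F1)(F2) (S2c) are NOT in this file. No variety, sheaf or semiregularity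
map is constructed; nothing here says HC ∕ HC_CM ∕ HC_AV holds; no fact, no definition, no instance, no notation. REUSE:
rows 716, 731, 739, 781, S2a. Sizing: TIER2-SIZING-TheoremLZetaMain-prove-1-g23.md §5. Typed ≠ proved ≠ endorsed.
-/

noncomputable section
namespace Summit.Ventures.HSemireg.Pad4FirstOrder
open Finset

/-- if a section `P → N` exists and `P` is charged on `f`, then `N` carries `P`'s `f`-phase ((P0): `N` lies on `P`'s ray). -/
theorem phase_eq_of_idxH0_of_charged (N P : Constituent) (f : Fin 4) (a : Fin 4 → ℕ × ℕ) (ha : a ∈ idxH0 N P)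
    (hf : P.charge f ≠ 0) : N.phase f = P.phase f := by
  have hag : (idx (rel N P f) 0).Nonempty := ⟨a f, (mem_idxH0_iff N P a).1 ha f⟩
  rcases rel_eq_of_idx_zero_nonempty N P f hag with ⟨-, -, h⟩ | ⟨-, -, h⟩ <;> exact h.resolve_left hf

/-- **THE UPPER RAY RULE (THEOREM C′ «only if» at a `P`-constituent charged on two factors, in the kernel).** In any design
with `Minimal` sections, if the `E₊`-side system of `P j`, charged on `σ` and on `f ≠ σ`, is solvable at `κ₀ = E_{fσ}`,
then some `N i` is a σ-ray partner strictly above `P j` — same layer, the same letter on every `g ≠ σ`, σ-charge larger,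
`P j`'s σ-phase — joined to `P j` by a non-zero section coordinate. -/
theorem rayRule_upper (D : Design) (φ : D.Sections) (hmin : D.Minimal φ) (j : Fin D.nP) (σ f : Fin 4)
    (hσf : σ ≠ f) (hσ : (D.P j).charge σ ≠ 0) (hf : (D.P j).charge f ≠ 0)
    (h : D.UpperRowSolvable φ (Matrix.of fun a b => if a = f ∧ b = σ then (1 : ℂ) else 0) j) :
    ∃ i : Fin D.nN, (D.N i).layer = (D.P j).layer ∧ (∀ g, g ≠ σ → rel (D.N i) (D.P j) g = Rel.zero) ∧
      (D.P j).charge σ < (D.N i).charge σ ∧ (D.N i).phase σ = (D.P j).phase σ ∧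
      ∃ a ∈ idxH0 (D.N i) (D.P j), φ i j a ≠ 0 := by
  classical
  obtain ⟨η, hη⟩ := h
  have hoB : (qPair σ f, Function.update (fun _ => ((0 : ℕ), (0 : ℕ))) f (1, 0)) ∈ idxH2 (D.P j) (D.P j) :=
    mem_idxH2_self_qPair _ σ f hσf _ fun g => by
      by_cases hg : g = f
      · subst hg; exact Or.inr ⟨Function.update_self .., Or.inr rfl⟩
      · exact Or.inl (Function.update_of_ne hg ..)
  have hoA : (qPair σ f, Function.update (fun _ => ((0 : ℕ), (0 : ℕ))) f (0, 0)) ∈ idxH2 (D.P j) (D.P j) :=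
    mem_idxH2_self_qPair _ σ f hσf _ fun g => Or.inl (by
      by_cases hg : g = f
      · subst hg; exact Function.update_self ..
      · exact Function.update_of_ne hg ..)
  have eB := hη j (D.upperRowPure_self j) _ hoB
  have eA := hη j (D.upperRowPure_self j) _ hoA
  rw [if_pos rfl] at eB eA
  have key : D.upperLHS φ η j j (qPair σ f, Function.update (fun _ => ((0 : ℕ), (0 : ℕ))) f (1, 0)) -
      zetaBar ((D.P j).phase f) *
        D.upperLHS φ η j j (qPair σ f, Function.update (fun _ => ((0 : ℕ), (0 : ℕ))) f (0, 0)) ≠ 0 := by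
    rw [eB, eA]; exact ob_qPair_wImage_E_ne_zero (D.P j) σ f hσf hσ _ rfl
  by_contra hno
  push Not at hno
  apply key
  simp only [Design.upperLHS, Finset.mul_sum, ← Finset.sum_sub_distrib]
  refine Finset.sum_eq_zero fun i _ => Finset.sum_eq_zero fun u hu => Finset.sum_eq_zero fun a ha => ?_
  by_cases hu1 : u.1 = qPair σ f
  swap
  · rw [if_neg hu1, if_neg hu1]; ring
  rw [if_pos hu1, if_pos hu1]
  -- every participant `N i ≥ P j` carries `P j`'s `f`-phase (this is where the second charged factor is used)
  rw [← phase_eq_of_idxH0_of_charged (D.N i) (D.P j) f a ha hf]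
  by_cases hoff : ∃ g₁, g₁ ≠ σ ∧ rel (D.N i) (D.P j) g₁ ≠ Rel.zero
  · obtain ⟨g₁, hg₁, hne⟩ := hoff
    have hc := coefProd_wImage_eq_zero (D.N i) (D.P j) σ f hσf u hu hu1 a ha g₁ hg₁ hne
    linear_combination (φ i j a * η i u.1 u.2) * hc
  · push Not at hoff
    by_cases hσ0 : rel (D.N i) (D.P j) σ = Rel.zero
    · have hall : ∀ g, rel (D.N i) (D.P j) g = Rel.zero := fun g => by
        by_cases hg : g = σ
        · subst hg; exact hσ0
        · exact hoff g hg
      rw [hmin i j hall a]; ring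
    · have hag : (idx (rel (D.N i) (D.P j) σ) 0).Nonempty := ⟨a σ, (mem_idxH0_iff _ _ a).1 ha σ⟩
      have hl := layer_eq_of_idx_zero_nonempty _ _ σ hag
      rcases rel_eq_of_idx_zero_nonempty _ _ σ hag with ⟨hz, -, -⟩ | ⟨-, hlt, hph⟩
      · exact absurd hz hσ0
      rw [hno i hl hoff hlt (hph.resolve_left hσ) a ha]; ring

end Summit.Ventures.HSemireg.Pad4FirstOrder
end
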